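import Literature.MathematicalPhysics.QuantumFieldTheory.Balaban1983to89.B4RandomWalk213

/-!
# `BalabanImbrieJaffe1984to88.BIJ88WalkGeometry246` — T. Bałaban, J. Imbrie, A. Jaffe, *Effective action and cluster
properties of the abelian Higgs model*, Commun. Math. Phys. **114** (1988) 257–315 [BalabanImbrieJaffe1988]:
Sect. 2 p. 264, the MECHANISM behind the bound (2.46) `|C^{(k)}_{Λ,X}(u; x₁, x₂)| ≦ e^{−cr(e_k)|X|}` — walk-length
geometry (a walk whose cubes fill `X` is long) and the geometric tail of the random walk expansion — PROVED as
carrier-neutral lemmas over the walk calculus of [6] = [Balaban1983RegularityDecay] (`Balaban1983to89.B4RandomWalk213`).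

statement-level skeleton of published theorems with citation tags; proofs where landed; nothing here is a claim about the Yang–Mills mass gap

PDF held: `paper:balaban1988-cmp114-bij-abelian-higgs-effective-action` (journal page = PDF page + 256).  Page read as an
image (poppler ×3 crop of PDF p. 8 = journal 264, and p. 9 = 265).

TEXT UNDER FORMALIZATION (p. 264, verbatim): *"and the convergence and locality properties of the random walk expansion
imply the following facts about these operators. … The operator C^{(k)}_{Λ,X}(u) depends only on u in X. It vanishes
unless both arguments are in X, and is estimated as follows: |C^{(k)}_{Λ,X}(u; x₁, x₂)| ≦ e^{−cr(e_k)|X|}. (2.46)"*;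
p. 265: *"Here and elsewhere, |X| refers to the number of r(e_k)-cubes in X, not the volume of X."*  The walks of
(2.42)–(2.44) are walks *"on a lattice of spacing M = O(1)"* (p. 264) and `C^{(k)}_{Λ,X}` sums the walks *"which
remain within X⁰ and which intersect each cube of X⁰"*, `X⁰ ⊂ X` the `r(e_k)`-cubes met (reading R1 of the C2 fold,
HOME/STATUS 2026-08-21T01:19:00Z).

CITATION HEADER (lean-in-tree rule).  Part of the lit-balaban TYPED SKELETON (HOME `run/shared/lean/pub/lit-balaban/`),
Phase 2, seat p36 (gen 2, unit `lit-balaban-p36`), companion to seat p13's `BIJ88RandomWalk242` (rows C2.Eq2.42–2.45;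
this file does not import it and restates none of its declarations); row served: **C2.Eq2.46** (the BOUND; the typed
row is `BIJ88Sect2Statements.Ineq246`, whose instance over p13's `cX` is assembled in the sibling `BIJ88Ineq246Walks`).
WHAT IS REPRODUCED, and how — the two ingredients the sentence *"the convergence and locality properties of the random
walk expansion imply"* uses for (2.46), as kernel-checked lemmas with every constant explicit:
(a) §1–§2 WALK-LENGTH GEOMETRY.  `exists_far_subfamily`: among any finite set `Y` of `r(e_k)`-cubes, if every cube
  touches at most `K` cubes, a pairwise non-touching subfamily `F` with `|Y| ≤ K·|F|` (greedy selection);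
  `dist_ptAt_le`: along a nearest-neighbour walk the label distance grows at most by `1` per step; `far_family_le_length`:
  a walk visiting `m + 1` pairwise-far cubes, far cubes being `≥ s` steps apart, has length `≥ m·s` (induction on the
  last-discovered cube); assembled in `length_lower_bound`: a walk meeting the cube set `X⁰` has length
  `≥ (q − 1)·s` for some `q` with `|X⁰| ≤ K·q`; `card_le_of_covered`: `|X| ≤ K′·|X⁰|` for the boundary-layer closure.
(b) §3 THE GEOMETRIC TAIL.  On the walk tuples `(n; ω₀, ω₁…ω_n)` of [6]: if the walk kernels are majorized by `A·βⁿ`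
  on nearest-neighbour walks starting in a set `S₀` of labels and vanish otherwise, every label has at most `D`
  neighbours ([6]: `D = 3^d`) and `Dβ < 1`, then the sum of the kernels over ANY set of walks of length `≥ N` is at most
  `|S₀|·A·(Dβ)^N/(1 − Dβ)` in absolute value (`abs_tsum_indicator_le`; at most `Dⁿ` walks of length `n` from a label,
  `B4RandomWalk213.card_walks_le`).
NOT here: the operators, the identification `s ≈ r(e_k)/M`, the constants `c` of (2.46) (sibling file), (2.47).
-/

namespace Literature.MathematicalPhysics.QuantumFieldTheory.BalabanImbrieJaffe1984to88.BIJ88WalkGeometry246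

open Finset
open Literature.MathematicalPhysics.QuantumFieldTheory.Balaban1983to89.B4RandomWalk213

/-! ## §1 Pairwise-far subfamilies of a finite set of cubes -/

section Far

variable {κ : Type*}

/-- a family of `r(e_k)`-cubes is PAIRWISE FAR when no two distinct members touch (the cubes of such a family are
`≥ r(e_k)` apart, so a walk of `M`-steps needs `≥ r(e_k)/M` steps between any two of them — the source of the factor
`r(e_k)|X|` in the exponent of (2.46)). [cite: BalabanImbrieJaffe1988, (2.46) p.264] -/
def PairwiseFar (touch : κ → κ → Prop) (F : Finset κ) : Prop :=
  ∀ c ∈ F, ∀ c' ∈ F, c ≠ c' → ¬ touch c c'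

/-- subfamilies of a pairwise-far family are pairwise far. [cite: BalabanImbrieJaffe1988, (2.46) p.264] -/
theorem PairwiseFar.mono {touch : κ → κ → Prop} {F G : Finset κ} (h : G ⊆ F) (hF : PairwiseFar touch F) :
    PairwiseFar touch G :=
  fun c hc c' hc' hne => hF c (h hc) c' (h hc') hne

variable [DecidableEq κ]

/-- **GREEDY SELECTION**: if touching is reflexive and symmetric and every cube touches at most `K` cubes of any set,
every finite set `Y` of cubes contains a pairwise-far subfamily `F` with `|Y| ≤ K·|F|`.
[cite: BalabanImbrieJaffe1988, (2.46) p.264] -/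
theorem exists_far_subfamily (touch : κ → κ → Prop) [DecidableRel touch] (hrefl : ∀ c, touch c c)
    (hsymm : ∀ c c', touch c c' → touch c' c) {K : ℕ}
    (hK : ∀ (c : κ) (Y : Finset κ), (Y.filter fun c' => touch c c').card ≤ K) (Y : Finset κ) :
    ∃ F ⊆ Y, PairwiseFar touch F ∧ Y.card ≤ K * F.card := by
  induction Y using Finset.strongInduction with
  | H Y ih =>
    rcases Y.eq_empty_or_nonempty with rfl | ⟨c, hc⟩
    · exact ⟨∅, Finset.Subset.refl _, fun _ h => absurd h (Finset.notMem_empty _), by simp⟩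
    · have hcY' : c ∉ Y.filter fun c' => ¬ touch c c' := fun h => (Finset.mem_filter.mp h).2 (hrefl c)
      have hsub : (Y.filter fun c' => ¬ touch c c') ⊂ Y :=
        Finset.filter_ssubset.mpr ⟨c, hc, not_not.mpr (hrefl c)⟩
      obtain ⟨F', hF'Y', hfar', hcard'⟩ := ih _ hsub
      have hcF' : c ∉ F' := fun h => hcY' (hF'Y' h)
      refine ⟨insert c F', Finset.insert_subset hc (hF'Y'.trans (Finset.filter_subset _ _)), ?_, ?_⟩
      · intro x hx y hy hne
        rcases Finset.mem_insert.mp hx with rfl | hx'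
        · rcases Finset.mem_insert.mp hy with rfl | hy'
          · exact absurd rfl hne
          · exact (Finset.mem_filter.mp (hF'Y' hy')).2
        · rcases Finset.mem_insert.mp hy with rfl | hy'
          · exact fun h => (Finset.mem_filter.mp (hF'Y' hx')).2 (hsymm _ _ h)
          · exact hfar' x hx' y hy' hne
      · rw [Finset.card_insert_of_notMem hcF',
          ← Finset.card_filter_add_card_filter_not (s := Y) (fun c' => touch c c')]
        have h := add_le_add (hK c Y) hcard'
        linarith

end Far

/-! ## §2 Walks read in time: the point at time `t`, distance per step, far cubes take many steps -/

section Timing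

variable {ι κ : Type*}

/-- the point `ω_t` of the walk `(ω₀; ω₁, …, ω_n)` = `(j; ys)` at time `t ≤ n` (`ω₀` for `t = 0`; junk value `ω₀`
for `t > n`). [cite: BalabanImbrieJaffe1988, (2.42) p.264] -/
def ptAt (j : ι) {n : ℕ} (ys : Fin n → ι) (t : ℕ) : ι :=
  if h : 0 < t ∧ t ≤ n then ys ⟨t - 1, by omega⟩ else j

/-- `ω_0 = ω₀`. [cite: BalabanImbrieJaffe1988, (2.42) p.264] -/
@[simp] theorem ptAt_zero (j : ι) {n : ℕ} (ys : Fin n → ι) : ptAt j ys 0 = j := by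
  simp [ptAt]

/-- `ω_{k+1} = ys k`. [cite: BalabanImbrieJaffe1988, (2.42) p.264] -/
theorem ptAt_succ (j : ι) {n : ℕ} (ys : Fin n → ι) (k : Fin n) : ptAt j ys (k + 1) = ys k := by
  unfold ptAt
  rw [dif_pos ⟨Nat.succ_pos _, k.2⟩]
  congr 1

/-- `ω_n` is [6]'s end-point `lastPt`. [cite: BalabanImbrieJaffe1988, (2.42) p.264] -/
theorem ptAt_length (j : ι) {n : ℕ} (ys : Fin n → ι) : ptAt j ys n = lastPt j n ys := by
  cases n with
  | zero => rw [ptAt_zero, lastPt_zero]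
  | succ n => rw [lastPt_succ, ← ptAt_succ j ys (Fin.last n), Fin.val_last]

/-- [6]'s tuple point `(Fin.cons ω₀ ys) k` for `k < n` is `ω_k`. [cite: BalabanImbrieJaffe1988, (2.42) p.264] -/
theorem cons_castSucc_eq_ptAt (j : ι) {n : ℕ} (ys : Fin n → ι) (k : Fin n) :
    (Fin.cons j ys : Fin (n + 1) → ι) k.castSucc = ptAt j ys k := by
  rcases k with ⟨k, hk⟩
  cases k with
  | zero =>
      have h0 : (⟨0, hk⟩ : Fin n).castSucc = 0 := Fin.ext rfl
      rw [h0, Fin.cons_zero]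
      exact (ptAt_zero j ys).symm
  | succ k =>
      have h1 : (⟨k + 1, hk⟩ : Fin n).castSucc = (⟨k, by omega⟩ : Fin n).succ := Fin.ext rfl
      rw [h1, Fin.cons_succ]
      exact (ptAt_succ j ys ⟨k, by omega⟩).symm

/-- consecutive points of a nearest-neighbour walk are adjacent: `ω_k ~ ω_{k+1}` for `k < n`.
[cite: BalabanImbrieJaffe1988, (2.42) p.264] -/
theorem adj_ptAt {adj : ι → ι → Prop} {j : ι} {n : ℕ} {ys : Fin n → ι} (hw : IsWalk adj j ys) {k : ℕ}
    (hk : k < n) : adj (ptAt j ys k) (ptAt j ys (k + 1)) := by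
  have h := hw ⟨k, hk⟩
  rw [cons_castSucc_eq_ptAt] at h
  rwa [ptAt_succ j ys ⟨k, hk⟩]

/-- the visited labels `{ω₀, ω₁, …, ω_n}` are exactly the points `ω_t`, `t ≤ n`. [cite: BalabanImbrieJaffe1988, (2.43) p.264] -/
theorem mem_pts_iff [DecidableEq ι] (j : ι) {n : ℕ} (ys : Fin n → ι) (l : ι) :
    l ∈ insert j (Finset.univ.image ys) ↔ ∃ t ≤ n, ptAt j ys t = l := by
  constructor
  · intro h
    rcases Finset.mem_insert.mp h with rfl | h
    · exact ⟨0, Nat.zero_le _, ptAt_zero _ _⟩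
    · obtain ⟨k, -, rfl⟩ := Finset.mem_image.mp h
      exact ⟨k + 1, k.2, ptAt_succ j ys k⟩
  · rintro ⟨t, ht, rfl⟩
    rcases Nat.eq_zero_or_pos t with rfl | hpos
    · rw [ptAt_zero]
      exact Finset.mem_insert_self _ _
    · obtain ⟨k, rfl⟩ : ∃ k, t = k + 1 := ⟨t - 1, by omega⟩
      rw [ptAt_succ j ys ⟨k, by omega⟩]
      exact Finset.mem_insert_of_mem (Finset.mem_image_of_mem _ (Finset.mem_univ _))

/-- **ONE UNIT PER STEP**: for a label distance `d` (zero on the diagonal, triangle inequality) with `d ≤ 1` across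
adjacent labels, along a nearest-neighbour walk `d(ω_{t₁}, ω_{t₂}) ≤ t₂ − t₁` ([6]: each `M`-step moves the cube
label by sup-norm `≤ 1`). [cite: BalabanImbrieJaffe1988, (2.46) p.264] -/
theorem dist_ptAt_le (d : ι → ι → ℝ) (hd0 : ∀ i, d i i = 0) (htri : ∀ i j l, d i l ≤ d i j + d j l)
    {adj : ι → ι → Prop} (hadj : ∀ i l, adj i l → d i l ≤ 1) {j : ι} {n : ℕ} {ys : Fin n → ι}
    (hw : IsWalk adj j ys) {t₁ t₂ : ℕ} (h12 : t₁ ≤ t₂) (h2 : t₂ ≤ n) :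
    d (ptAt j ys t₁) (ptAt j ys t₂) ≤ ((t₂ - t₁ : ℕ) : ℝ) := by
  obtain ⟨m, rfl⟩ := Nat.exists_eq_add_of_le h12
  rw [Nat.add_sub_cancel_left]
  clear h12
  induction m with
  | zero => simp [hd0]
  | succ m ih =>
      calc d (ptAt j ys t₁) (ptAt j ys (t₁ + (m + 1)))
          ≤ d (ptAt j ys t₁) (ptAt j ys (t₁ + m)) + d (ptAt j ys (t₁ + m)) (ptAt j ys (t₁ + m + 1)) := by
            rw [← Nat.add_assoc]; exact htri _ _ _
        _ ≤ (m : ℝ) + 1 := add_le_add (ih (by omega)) (hadj _ _ (adj_ptAt hw (by omega)))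
        _ = ((m + 1 : ℕ) : ℝ) := by push_cast; ring

/-- **FAR CUBES TAKE MANY STEPS**: if far (= non-touching) cubes along the walk are always `≥ s` time units apart
(`hsep`), then a pairwise-far family of `m + 1` cubes all visited by time `T` forces `m·s ≤ T` (induction on the cube
of the family discovered last). [cite: BalabanImbrieJaffe1988, (2.46) p.264] -/
theorem far_family_le_length {j : ι} {n : ℕ} {ys : Fin n → ι} (cube : ι → κ) (touch : κ → κ → Prop) (s : ℕ)
    (hsep : ∀ t₁ t₂ : ℕ, t₁ ≤ t₂ → t₂ ≤ n →
      ¬ touch (cube (ptAt j ys t₁)) (cube (ptAt j ys t₂)) → s ≤ t₂ - t₁) :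
    ∀ (m : ℕ) (F : Finset κ), F.card = m + 1 → PairwiseFar touch F →
      ∀ T : ℕ, (∀ Q ∈ F, ∃ t, t ≤ T ∧ t ≤ n ∧ cube (ptAt j ys t) = Q) → m * s ≤ T := by
  classical
  intro m
  induction m with
  | zero => intros; simp
  | succ m ih =>
      intro F hcard hfar T hvis
      choose! τ hτT hτn hτQ using hvis
      have hne : F.Nonempty := by rw [← Finset.card_pos, hcard]; omega
      obtain ⟨Qs, hQs, hmax⟩ := Finset.exists_max_image F τ hne
      have hcard' : (F.erase Qs).card = m + 1 := by rw [Finset.card_erase_of_mem hQs, hcard]; rfl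
      have hne' : (F.erase Qs).Nonempty := by rw [← Finset.card_pos, hcard']; omega
      obtain ⟨Q', hQ', hmax'⟩ := Finset.exists_max_image (F.erase Qs) τ hne'
      have hQ'F : Q' ∈ F := Finset.mem_of_mem_erase hQ'
      have hih : m * s ≤ τ Q' :=
        ih (F.erase Qs) hcard' (hfar.mono (Finset.erase_subset _ _)) (τ Q') fun Q hQ =>
          ⟨τ Q, hmax' Q hQ, hτn Q (Finset.mem_of_mem_erase hQ), hτQ Q (Finset.mem_of_mem_erase hQ)⟩
      have hnt : ¬ touch (cube (ptAt j ys (τ Q'))) (cube (ptAt j ys (τ Qs))) := by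
        rw [hτQ Q' hQ'F, hτQ Qs hQs]
        exact hfar Q' hQ'F Qs hQs (Finset.ne_of_mem_erase hQ')
      have hgap : s ≤ τ Qs - τ Q' := hsep _ _ (hmax Q' hQ'F) (hτn Qs hQs) hnt
      have hT : τ Qs ≤ T := hτT Qs hQs
      have hle : τ Q' ≤ τ Qs := hmax Q' hQ'F
      rw [Nat.succ_mul]
      omega

variable [DecidableEq ι] [DecidableEq κ]

/-- **LENGTH LOWER BOUND**: with touching reflexive, symmetric, of degree `≤ K`, and far cubes `≥ s` time units apart
along the walk, a walk `(ω₀; ω₁…ω_n)` meeting the `r(e_k)`-cubes `X⁰ = cube({ω₀,…,ω_n})` satisfies `(q − 1)·s ≤ n`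
for some `q` with `|X⁰| ≤ K·q` — *walks filling `X` are long*. [cite: BalabanImbrieJaffe1988, (2.46) p.264] -/
theorem length_lower_bound {j : ι} {n : ℕ} {ys : Fin n → ι} (cube : ι → κ) (touch : κ → κ → Prop)
    [DecidableRel touch] (hrefl : ∀ c, touch c c) (hsymm : ∀ c c', touch c c' → touch c' c) {K : ℕ}
    (hK : ∀ (c : κ) (Y : Finset κ), (Y.filter fun c' => touch c c').card ≤ K) (s : ℕ)
    (hsep : ∀ t₁ t₂ : ℕ, t₁ ≤ t₂ → t₂ ≤ n →
      ¬ touch (cube (ptAt j ys t₁)) (cube (ptAt j ys t₂)) → s ≤ t₂ - t₁) :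
    ∃ q : ℕ, ((insert j (Finset.univ.image ys)).image cube).card ≤ K * q ∧ (q - 1) * s ≤ n := by
  obtain ⟨F, hFX, hfar, hcard⟩ :=
    exists_far_subfamily touch hrefl hsymm hK ((insert j (Finset.univ.image ys)).image cube)
  refine ⟨F.card, hcard, ?_⟩
  rcases Nat.eq_zero_or_pos F.card with h0 | hpos
  · simp [h0]
  · obtain ⟨m, hm⟩ : ∃ m, F.card = m + 1 := ⟨F.card - 1, by omega⟩
    rw [hm, Nat.add_sub_cancel]
    refine far_family_le_length cube touch s hsep m F hm hfar n fun Q hQ => ?_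
    obtain ⟨l, hl, rfl⟩ := Finset.mem_image.mp (hFX hQ)
    obtain ⟨t, ht, rfl⟩ := (mem_pts_iff j ys l).mp hl
    exact ⟨t, ht, ht, rfl⟩

/-- **CLOSURE GROWTH**: if every cube of `T` equals or neighbours a cube of `S` (`T ⊆` the boundary-layer closure of
`S`) and every cube has at most `K′` such neighbours, then `|T| ≤ K′·|S|` — so `|X| ≤ K′·|X⁰|`.
[cite: BalabanImbrieJaffe1988, (2.46) p.264] -/
theorem card_le_of_covered [Fintype κ] (nb : κ → κ → Prop) [DecidableRel nb] {K' : ℕ}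
    (hK' : ∀ c, (Finset.univ.filter fun c' => nb c c').card ≤ K') (S T : Finset κ)
    (hT : ∀ c' ∈ T, ∃ c ∈ S, nb c c') : T.card ≤ K' * S.card := by
  calc T.card ≤ (S.biUnion fun c => Finset.univ.filter fun c' => nb c c').card :=
        Finset.card_le_card fun c' hc' => by
          obtain ⟨c, hc, h⟩ := hT c' hc'
          exact Finset.mem_biUnion.mpr ⟨c, hc, Finset.mem_filter.mpr ⟨Finset.mem_univ _, h⟩⟩
    _ ≤ ∑ c ∈ S, (Finset.univ.filter fun c' => nb c c').card := Finset.card_biUnion_le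
    _ ≤ ∑ _c ∈ S, K' := Finset.sum_le_sum fun c _ => hK' c
    _ = K' * S.card := by rw [Finset.sum_const, smul_eq_mul, mul_comm]

end Timing

/-! ## §3 The geometric tail of the walk expansion over the tuples of [6] -/

section Tail

variable {ι : Type*} [DecidableEq ι]

/-- [6]'s walk tuples `(n; ω₀, (ω₁, …, ω_n))`. [cite: BalabanImbrieJaffe1988, (2.42) p.264] -/
abbrev Tup (ι : Type*) := Σ n : ℕ, ι × (Fin n → ι)

/-- the MAJORANT of the walk kernels used for the tail: `A·βⁿ` on nearest-neighbour walks of length `n ≥ N` issuing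
from `S₀`, `0` otherwise. [cite: BalabanImbrieJaffe1988, (2.46) p.264] -/
noncomputable def maj (adj : ι → ι → Prop) [DecidableRel adj] (S₀ : Finset ι) (A β : ℝ) (N : ℕ) (p : Tup ι) : ℝ :=
  if IsWalk adj p.2.1 p.2.2 ∧ p.2.1 ∈ S₀ ∧ N ≤ p.1 then A * β ^ p.1 else 0

/-- the majorant is nonnegative for `A, β ≥ 0`. [cite: BalabanImbrieJaffe1988, (2.46) p.264] -/
theorem maj_nonneg (adj : ι → ι → Prop) [DecidableRel adj] (S₀ : Finset ι) {A β : ℝ} (hA : 0 ≤ A) (hβ0 : 0 ≤ β)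
    (N : ℕ) (p : Tup ι) : 0 ≤ maj adj S₀ A β N p := by
  unfold maj
  split_ifs
  · exact mul_nonneg hA (pow_nonneg hβ0 _)
  · exact le_rfl

variable [Fintype ι]

/-- **LEVEL SUMS**: at length `n` the majorant sums to at most `|S₀|·A·(Dβ)ⁿ` (at most `Dⁿ` nearest-neighbour walks of
length `n` from each label of `S₀`, [6] p. 579 / `B4RandomWalk213.card_walks_le`), and to `0` below the cutoff `N`.
[cite: BalabanImbrieJaffe1988, (2.46) p.264] -/
theorem level_sum_maj_le (adj : ι → ι → Prop) [DecidableRel adj] (S₀ : Finset ι) {A β : ℝ} {D : ℕ} (N : ℕ)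
    (hA : 0 ≤ A) (hβ0 : 0 ≤ β) (hD : ∀ j, (Finset.univ.filter fun i => adj j i).card ≤ D) (n : ℕ) :
    ∑ c : ι × (Fin n → ι), maj adj S₀ A β N ⟨n, c⟩ ≤
      if N ≤ n then S₀.card * A * ((D : ℝ) * β) ^ n else 0 := by
  split_ifs with hN
  · rw [Fintype.sum_prod_type]
    have hi : ∀ i, ∑ ys : Fin n → ι, maj adj S₀ A β N ⟨n, (i, ys)⟩ ≤
        if i ∈ S₀ then A * ((D : ℝ) * β) ^ n else 0 := fun i => by
      split_ifs with hi
      · have h1 : ∑ ys : Fin n → ι, maj adj S₀ A β N ⟨n, (i, ys)⟩ =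
            ∑ ys ∈ walks adj i n, maj adj S₀ A β N ⟨n, (i, ys)⟩ :=
          (Finset.sum_subset (Finset.subset_univ _) fun ys _ hys => by
            unfold maj; exact if_neg fun h => hys (mem_walks.mpr h.1)).symm
        have h2 : ∑ ys ∈ walks adj i n, maj adj S₀ A β N ⟨n, (i, ys)⟩ = ∑ _ys ∈ walks adj i n, A * β ^ n :=
          Finset.sum_congr rfl fun ys hys => by unfold maj; exact if_pos ⟨mem_walks.mp hys, hi, hN⟩
        rw [h1, h2, Finset.sum_const, nsmul_eq_mul]
        calc ((walks adj i n).card : ℝ) * (A * β ^ n) ≤ (D : ℝ) ^ n * (A * β ^ n) :=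
              mul_le_mul_of_nonneg_right (by exact_mod_cast card_walks_le adj hD n i)
                (mul_nonneg hA (pow_nonneg hβ0 n))
          _ = A * ((D : ℝ) * β) ^ n := by rw [mul_pow]; ring
      · exact le_of_eq (Finset.sum_eq_zero fun ys _ => by unfold maj; exact if_neg fun h => hi h.2.1)
    calc ∑ i, ∑ ys : Fin n → ι, maj adj S₀ A β N ⟨n, (i, ys)⟩
        ≤ ∑ i, (if i ∈ S₀ then A * ((D : ℝ) * β) ^ n else 0) := Finset.sum_le_sum fun i _ => hi i
      _ = ∑ _i ∈ S₀, A * ((D : ℝ) * β) ^ n := by rw [Finset.sum_ite_mem, Finset.univ_inter]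
      _ = S₀.card * A * ((D : ℝ) * β) ^ n := by rw [Finset.sum_const, nsmul_eq_mul, mul_assoc]
  · exact le_of_eq (Finset.sum_eq_zero fun c _ => by unfold maj; exact if_neg fun h => hN h.2.2)

/-- the majorant is summable over all tuples when `Dβ < 1` (geometric series in the length).
[cite: BalabanImbrieJaffe1988, (2.46) p.264] -/
theorem summable_maj (adj : ι → ι → Prop) [DecidableRel adj] (S₀ : Finset ι) {A β : ℝ} {D : ℕ} (N : ℕ)
    (hA : 0 ≤ A) (hβ0 : 0 ≤ β) (hD : ∀ j, (Finset.univ.filter fun i => adj j i).card ≤ D)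
    (hθ : (D : ℝ) * β < 1) : Summable (maj adj S₀ A β N) := by
  have hθ0 : 0 ≤ (D : ℝ) * β := mul_nonneg (Nat.cast_nonneg D) hβ0
  refine (summable_sigma_of_nonneg (maj_nonneg adj S₀ hA hβ0 N)).2
    ⟨fun n => (hasSum_fintype _).summable, ?_⟩
  refine Summable.of_nonneg_of_le (fun n => tsum_nonneg fun _ => maj_nonneg adj S₀ hA hβ0 N _)
    (fun n => ?_) ((summable_geometric_of_lt_one hθ0 hθ).mul_left (S₀.card * A))
  rw [tsum_fintype]
  refine (level_sum_maj_le adj S₀ N hA hβ0 hD n).trans ?_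
  split_ifs
  · exact le_rfl
  · exact mul_nonneg (mul_nonneg (Nat.cast_nonneg _) hA) (pow_nonneg hθ0 n)

/-- the value of the geometric tail: `Σ_{n ≥ N} cθⁿ = cθ^N/(1 − θ)`. [cite: BalabanImbrieJaffe1988, (2.46) p.264] -/
theorem hasSum_tail (c θ : ℝ) (hθ0 : 0 ≤ θ) (hθ : θ < 1) (N : ℕ) :
    HasSum (fun n : ℕ => if N ≤ n then c * θ ^ n else 0) (c * θ ^ N / (1 - θ)) := by
  refine (hasSum_nat_add_iff' N).mp ?_
  have h0 : ∑ i ∈ Finset.range N, (if N ≤ i then c * θ ^ i else 0) = 0 :=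
    Finset.sum_eq_zero fun i hi => if_neg (not_le.mpr (Finset.mem_range.mp hi))
  rw [h0, sub_zero]
  have h := (hasSum_geometric_of_lt_one hθ0 hθ).mul_left (c * θ ^ N)
  have hfun : (fun n : ℕ => if N ≤ n + N then c * θ ^ (n + N) else 0) = fun i => c * θ ^ N * θ ^ i := by
    funext m
    rw [if_pos (Nat.le_add_left N m), pow_add]
    ring
  show HasSum (fun n : ℕ => if N ≤ n + N then c * θ ^ (n + N) else 0) (c * θ ^ N / (1 - θ))
  rw [hfun, div_eq_mul_inv]
  exact h

/-- **THE GEOMETRIC TAIL OF THE WALK EXPANSION**: if the real walk kernels `f` are majorized by `A·βⁿ` on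
nearest-neighbour walks issuing from `S₀` and vanish otherwise, every label has at most `D` neighbours and `Dβ < 1`,
then over ANY set `S` of walks all of length `≥ N`, `|Σ_{ω ∈ S} f(ω)| ≤ |S₀|·A·(Dβ)^N/(1 − Dβ)` — *"the convergence
… properties of the random walk expansion"* behind (2.46). [cite: BalabanImbrieJaffe1988, (2.46) p.264] -/
theorem abs_tsum_indicator_le (adj : ι → ι → Prop) [DecidableRel adj] (S₀ : Finset ι) {A β : ℝ} {D N : ℕ}
    (hA : 0 ≤ A) (hβ0 : 0 ≤ β) (hD : ∀ j, (Finset.univ.filter fun i => adj j i).card ≤ D)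
    (hθ : (D : ℝ) * β < 1) (f : Tup ι → ℝ) (S : Set (Tup ι))
    (hf : ∀ p, |f p| ≤ if IsWalk adj p.2.1 p.2.2 ∧ p.2.1 ∈ S₀ then A * β ^ p.1 else 0)
    (hS : ∀ p ∈ S, N ≤ p.1) :
    |∑' p, S.indicator f p| ≤ S₀.card * A * ((D : ℝ) * β) ^ N / (1 - D * β) := by
  classical
  have hθ0 : 0 ≤ (D : ℝ) * β := mul_nonneg (Nat.cast_nonneg D) hβ0
  have hg : Summable (maj adj S₀ A β N) := summable_maj adj S₀ N hA hβ0 hD hθ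
  have hpt : ∀ p, ‖S.indicator f p‖ ≤ maj adj S₀ A β N p := fun p => by
    rw [Real.norm_eq_abs]
    by_cases hp : p ∈ S
    · rw [Set.indicator_of_mem hp]
      refine (hf p).trans (le_of_eq ?_)
      unfold maj
      by_cases hc : IsWalk adj p.2.1 p.2.2 ∧ p.2.1 ∈ S₀
      · rw [if_pos hc, if_pos ⟨hc.1, hc.2, hS p hp⟩]
      · rw [if_neg hc, if_neg fun h => hc ⟨h.1, h.2.1⟩]
    · rw [Set.indicator_of_notMem hp, abs_zero]
      exact maj_nonneg adj S₀ hA hβ0 N p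
  have h1 : HasSum (fun n : ℕ => ∑ c : ι × (Fin n → ι), maj adj S₀ A β N ⟨n, c⟩) (∑' p, maj adj S₀ A β N p) :=
    hg.hasSum.sigma fun n => hasSum_fintype _
  have hval : ∑' p, maj adj S₀ A β N p ≤ S₀.card * A * ((D : ℝ) * β) ^ N / (1 - D * β) :=
    hasSum_le (fun n => level_sum_maj_le adj S₀ N hA hβ0 hD n) h1 (hasSum_tail _ _ hθ0 hθ N)
  rw [← Real.norm_eq_abs]
  exact (tsum_of_norm_bounded hg.hasSum hpt).trans hval

end Tail

end Literature.MathematicalPhysics.QuantumFieldTheory.BalabanImbrieJaffe1984to88.BIJ88WalkGeometry246
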